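import Mathlib.FieldTheory.Galois.Infinite
import Mathlib.FieldTheory.IsAlgClosed.AlgebraicClosure
import Literature.IUT.HodgeTheaters.KappaCoricGalois
import Literature.IUT.HodgeTheaters.KappaCoricFunctionsProofs
import HarnessLib

/-!
# [IUTchI] Example 5.1 (i), p. 124: "`𝕄^⊛_κ(†𝒟^⊚)` may be identified with the subset of `π₁^rat(†𝒟^⊛)`-invariants
# of `𝕄^⊛_∞κ(†𝒟^⊚)`" — PROVED at abc-iut-L5-t2's model of the coric rational functions (proof-only companion)

S. Mochizuki, *Inter-universal Teichmüller theory I*, kurims manuscript (May 2020), §5 Example 5.1 (i) p. 124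
l. 9–15: "we obtain natural isomorphs … `𝕄^⊛_κ(†𝒟^⊚)`, `𝕄^⊛_∞κ(†𝒟^⊚)`, `𝕄^⊛_∞κ×(†𝒟^⊚)` of the pseudo-monoids of `κ`-,
`∞κ`-, and `∞κ×`-coric rational functions associated to `C_{F_mod}` [cf. Remark 3.1.7], equipped with natural
`π₁^rat(†𝒟^⊛)`-actions.  Thus, `𝕄^⊛_κ(†𝒟^⊚)` may be identified with the subset of `π₁^rat(†𝒟^⊛)`-invariants of
`𝕄^⊛_∞κ(†𝒟^⊚)`", together with §3 Remark 3.1.7 (ii) p. 67: "an element `f ∈ L̄_C` is `∞κ`-coric if there exists a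
positive integer `n` such that `fⁿ` is a `κ`-coric element of `L_C`", "an element `f ∈ L_C` is `κ`-coric if and
only if it is `∞κ`-coric" ([IUTchI] Ex 5.1 (i) p.124, Rmk 3.1.7 (ii) p.67) [claim: Mochizuki2012, status: disputed]
(D-0012 claim key; the content here is elementary field theory at the MODEL — nothing disputed is involved and no
side is taken on [IUTchIII] Cor. 3.12).

## What is proved (cell abc-iut, sub-DAG `plan/L5/SUBDAG-IUTchI-Ex51.md` row E51/L04; FACT-LIST F-2571
`NFBridgeRecon.MκIsInvariants` is abc-iut-L5-t1's INTERFACE form of the same sentence — this file is its MODEL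
FORM at abc-iut-L5-t2's typing, exactly as `KappaCoricPseudoMonoidsProofs` is the model form of F-2575)

Setting (`KappaCoricGalois.lean`): `Ω` a field of characteristic `0` (`L̄`), `S : CriticalLocus Ω`, `Λ ⊇ Ω(t)` a
field (`L̄_C ⊇ L_C`; here `Ω(t) = RatFunc Ω`), `π₁^rat` modelled by the algebra automorphisms `Λ ≃ₐ[Ω(t)] Λ`.
* `isInftyKappaCoricIn_algebraMap_iff`, `…_iff_isKappaCoric`, `isInftyKappaUnitCoricIn_algebraMap_iff` — for a
  RATIONAL function `h`, "`h` is `∞κ`-coric in `L̄_C`" ⟺ "`h` is `∞κ`-coric in `L_C`" ⟺ "`h` is `κ`-coric"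
  (abc-iut-L5-t2's `kappaCoricIffInfty_holds`), and the `∞κ×` analogue;
* `IsInftyKappaCoricIn.map_algEquiv`, `IsInftyKappaUnitCoricIn.map_algEquiv`, `IsKappaSolvableIn.map_algEquiv`
  (+ `iff` forms) — the three subsets are STABLE under `Gal(L̄_C/L_C)` (the interface's `smul_mem_minfκ`,
  `smul_mem_minfκx` fields, at the model);
* **`isInftyKappaCoricIn_and_fixed_iff`, `setOf_isInftyKappaCoricIn_fixed_eq`** — for `Λ/Ω(t)` Galois (e.g. an
  algebraic closure, `Ω` of characteristic `0`): the `Gal(Λ/Ω(t))`-FIXED `∞κ`-coric elements of `Λ` are EXACTLY the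
  (images of the) `κ`-coric rational functions — the printed identification `𝕄^⊛_κ = (𝕄^⊛_∞κ)^{π₁^rat}` at the
  model (Galois descent `InfiniteGalois.mem_range_algebraMap_iff_fixed` + "`κ`-coric iff `∞κ`-coric");
* `isInftyKappaUnitCoricIn_and_fixed_iff` — likewise the fixed `∞κ×`-coric elements are the `∞κ×`-coric rational
  functions (Ex 5.1 (v) p. 128 bottom: the `π₁^rat`-invariant part of `𝕄^⊛_∞κ×`).

PROOF-ONLY: no definition, no instance, no notation, no new Prop fact.  typed ≠ proved elsewhere; a FACT-LIST row
about the INTERFACE is not discharged by a theorem about the MODEL (honest scope: this is model-level evidence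
for F-2571, not its discharge).
-/

namespace Literature.IUT.HodgeTheaters

namespace CriticalLocus

universe u v

variable {Ω : Type u} [Field Ω] [CharZero Ω] (S : CriticalLocus Ω) (Λ : Type v) [Field Λ]
  [Algebra (RatFunc Ω) Λ]

/-! ### Rational functions: `∞κ`-coric in `L̄_C` iff `∞κ`-coric in `L_C` iff `κ`-coric -/

/-- For a rational function `h ∈ L_C`, "`h` is `∞κ`-coric as an element of `L̄_C`" iff "`h` is `∞κ`-coric" in the
sense of `KappaCoricFunctions` (`L_C ↪ L̄_C` is injective, so `hⁿ = g` can be read in `L_C`).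
([IUTchI] Rmk 3.1.7 (ii) p.67) [claim: Mochizuki2012, status: disputed] -/
theorem isInftyKappaCoricIn_algebraMap_iff (h : RatFunc Ω) :
    S.IsInftyKappaCoricIn Λ (algebraMap (RatFunc Ω) Λ h) ↔ S.IsInftyKappaCoric h := by
  constructor
  · rintro ⟨n, hn, g, hg, hgh⟩
    have hng : h ^ n = g := (algebraMap (RatFunc Ω) Λ).injective (by rw [map_pow, hgh])
    exact ⟨n, hn, hng ▸ hg⟩
  · exact S.isInftyKappaCoricIn_of_isInftyKappaCoric Λ h

/-- For a rational function `h ∈ L_C`, "`h` is `∞κ`-coric in `L̄_C`" iff "`h` is `κ`-coric" — Rmk 3.1.7 (ii) "an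
element `f ∈ L_C` is `κ`-coric if and only if it is `∞κ`-coric" (abc-iut-L5-t2's `kappaCoricIffInfty_holds`).
([IUTchI] Rmk 3.1.7 (ii) p.67) [claim: Mochizuki2012, status: disputed] -/
theorem isInftyKappaCoricIn_algebraMap_iff_isKappaCoric (h : RatFunc Ω) :
    S.IsInftyKappaCoricIn Λ (algebraMap (RatFunc Ω) Λ h) ↔ S.IsKappaCoric h := by
  rw [isInftyKappaCoricIn_algebraMap_iff]
  exact (S.kappaCoricIffInfty_holds h).symm

/-- The `∞κ×` analogue: a rational function is `∞κ×`-coric in `L̄_C` iff it is `∞κ×`-coric in the sense of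
`KappaCoricFunctions` (same unit parameter `U = U_L`). ([IUTchI] Rmk 3.1.7 (ii) p.67)
[claim: Mochizuki2012, status: disputed] -/
theorem isInftyKappaUnitCoricIn_algebraMap_iff (U : Set Ω) (h : RatFunc Ω) :
    S.IsInftyKappaUnitCoricIn Λ U (algebraMap (RatFunc Ω) Λ h) ↔ S.IsInftyKappaUnitCoric U h := by
  constructor
  · rintro ⟨c, hc, hch⟩
    rw [← map_mul, isInftyKappaCoricIn_algebraMap_iff] at hch
    exact ⟨c, hc, hch⟩
  · rintro ⟨c, hc, hch⟩
    refine ⟨c, hc, ?_⟩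
    rw [← map_mul, isInftyKappaCoricIn_algebraMap_iff]
    exact hch

/-! ### Stability under `Gal(L̄_C/L_C)` (the interface fields `smul_mem_minfκ`, `smul_mem_minfκx` at the model) -/

/-- `∞κ`-coric elements are permuted by `Gal(L̄_C/L_C)`: `(σ f)ⁿ = σ(fⁿ) = σ(g) = g` for `g ∈ L_C`.
([IUTchI] Ex 5.1 (i) p.124) [claim: Mochizuki2012, status: disputed] -/
theorem IsInftyKappaCoricIn.map_algEquiv {f : Λ} (hf : S.IsInftyKappaCoricIn Λ f) (σ : Λ ≃ₐ[RatFunc Ω] Λ) :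
    S.IsInftyKappaCoricIn Λ (σ f) := by
  obtain ⟨n, hn, g, hg, hfg⟩ := hf
  exact ⟨n, hn, g, hg, by rw [← map_pow, hfg, AlgEquiv.commutes]⟩

/-- `iff` form of the `Gal(L̄_C/L_C)`-stability of the `∞κ`-coric elements. ([IUTchI] Ex 5.1 (i) p.124)
[claim: Mochizuki2012, status: disputed] -/
theorem isInftyKappaCoricIn_algEquiv_iff (σ : Λ ≃ₐ[RatFunc Ω] Λ) (f : Λ) :
    S.IsInftyKappaCoricIn Λ (σ f) ↔ S.IsInftyKappaCoricIn Λ f := by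
  refine ⟨fun h => ?_, fun h => h.map_algEquiv S Λ σ⟩
  have h' := h.map_algEquiv S Λ σ.symm
  rwa [AlgEquiv.symm_apply_apply] at h'

/-- `∞κ×`-coric elements are permuted by `Gal(L̄_C/L_C)` (the unit parameter `c ∈ U_L ⊆ L̄` is a constant, fixed by
`σ`). ([IUTchI] Ex 5.1 (i) p.124) [claim: Mochizuki2012, status: disputed] -/
theorem IsInftyKappaUnitCoricIn.map_algEquiv {U : Set Ω} {f : Λ} (hf : S.IsInftyKappaUnitCoricIn Λ U f)
    (σ : Λ ≃ₐ[RatFunc Ω] Λ) : S.IsInftyKappaUnitCoricIn Λ U (σ f) := by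
  obtain ⟨c, hc, h⟩ := hf
  refine ⟨c, hc, ?_⟩
  have h' := h.map_algEquiv S Λ σ
  rwa [map_mul, AlgEquiv.commutes] at h'

/-- `iff` form of the `Gal(L̄_C/L_C)`-stability of the `∞κ×`-coric elements. ([IUTchI] Ex 5.1 (i) p.124)
[claim: Mochizuki2012, status: disputed] -/
theorem isInftyKappaUnitCoricIn_algEquiv_iff (U : Set Ω) (σ : Λ ≃ₐ[RatFunc Ω] Λ) (f : Λ) :
    S.IsInftyKappaUnitCoricIn Λ U (σ f) ↔ S.IsInftyKappaUnitCoricIn Λ U f := by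
  refine ⟨fun h => ?_, fun h => h.map_algEquiv S Λ σ⟩
  have h' := h.map_algEquiv S Λ σ.symm
  rwa [AlgEquiv.symm_apply_apply] at h'

/-- `κ`-solvable elements are permuted by `Gal(L̄_C/L_C)` (Rmk 3.1.7 (iii): `F_sol^×`-multiples of `∞κ`-coric
elements; the multiplier is a constant). ([IUTchI] Rmk 3.1.7 (iii) p.67) [claim: Mochizuki2012, status: disputed] -/
theorem IsKappaSolvableIn.map_algEquiv {Fsol : Set Ω} {f : Λ} (hf : S.IsKappaSolvableIn Λ Fsol f)
    (σ : Λ ≃ₐ[RatFunc Ω] Λ) : S.IsKappaSolvableIn Λ Fsol (σ f) := by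
  obtain ⟨c, hc, hc0, g, hg, rfl⟩ := hf
  exact ⟨c, hc, hc0, σ g, hg.map_algEquiv S Λ σ, by rw [map_mul, AlgEquiv.commutes]⟩

/-! ### Ex 5.1 (i) p. 124: `𝕄^⊛_κ = (𝕄^⊛_∞κ)^{π₁^rat}` at the model -/

/-- **"`𝕄^⊛_κ(†𝒟^⊚)` may be identified with the subset of `π₁^rat(†𝒟^⊛)`-invariants of `𝕄^⊛_∞κ(†𝒟^⊚)`"** at the
model: for `Λ ⊇ L_C = Ω(t)` Galois (e.g. `Λ = L̄_C` an algebraic closure, characteristic `0`), an element of `Λ` is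
`∞κ`-coric AND fixed by every `σ ∈ Gal(Λ/L_C)` iff it is (the image of) a `κ`-coric rational function.  Proof:
Galois descent (`InfiniteGalois.mem_range_algebraMap_iff_fixed`) + "`κ`-coric iff `∞κ`-coric" (Rmk 3.1.7 (ii)).
This is the MODEL FORM of the interface law `NFBridgeRecon.MκIsInvariants` (FACT-LIST F-2571), not its discharge.
([IUTchI] Ex 5.1 (i) p.124) [claim: Mochizuki2012, status: disputed] -/
theorem isInftyKappaCoricIn_and_fixed_iff [IsGalois (RatFunc Ω) Λ] (f : Λ) :
    (S.IsInftyKappaCoricIn Λ f ∧ ∀ σ : Λ ≃ₐ[RatFunc Ω] Λ, σ f = f) ↔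
      ∃ g : RatFunc Ω, S.IsKappaCoric g ∧ algebraMap (RatFunc Ω) Λ g = f := by
  constructor
  · rintro ⟨hf, hfix⟩
    obtain ⟨g, rfl⟩ := (InfiniteGalois.mem_range_algebraMap_iff_fixed f).mpr hfix
    exact ⟨g, (S.isInftyKappaCoricIn_algebraMap_iff_isKappaCoric Λ g).mp hf, rfl⟩
  · rintro ⟨g, hg, rfl⟩
    exact ⟨(S.isInftyKappaCoricIn_algebraMap_iff_isKappaCoric Λ g).mpr hg, fun σ => σ.commutes g⟩

/-- Set form of the identification `𝕄^⊛_κ = (𝕄^⊛_∞κ)^{π₁^rat}` at the model: the fixed `∞κ`-coric elements of `Λ`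
are the image of the `κ`-coric rational functions under `L_C ↪ L̄_C`.
([IUTchI] Ex 5.1 (i) p.124) [claim: Mochizuki2012, status: disputed] -/
theorem setOf_isInftyKappaCoricIn_fixed_eq [IsGalois (RatFunc Ω) Λ] :
    {f : Λ | S.IsInftyKappaCoricIn Λ f ∧ ∀ σ : Λ ≃ₐ[RatFunc Ω] Λ, σ f = f} =
      algebraMap (RatFunc Ω) Λ '' {g : RatFunc Ω | S.IsKappaCoric g} := by
  ext f
  simp only [Set.mem_setOf_eq, Set.mem_image]
  exact S.isInftyKappaCoricIn_and_fixed_iff Λ f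

/-- The `∞κ×` analogue (Ex 5.1 (v) p. 128, the `π₁^rat`-invariant part of `𝕄^⊛_∞κ×`): the fixed `∞κ×`-coric elements of
`Λ` are exactly the (images of the) `∞κ×`-coric rational functions. ([IUTchI] Ex 5.1 (v) p.128)
[claim: Mochizuki2012, status: disputed] -/
theorem isInftyKappaUnitCoricIn_and_fixed_iff [IsGalois (RatFunc Ω) Λ] (U : Set Ω) (f : Λ) :
    (S.IsInftyKappaUnitCoricIn Λ U f ∧ ∀ σ : Λ ≃ₐ[RatFunc Ω] Λ, σ f = f) ↔
      ∃ h : RatFunc Ω, S.IsInftyKappaUnitCoric U h ∧ algebraMap (RatFunc Ω) Λ h = f := by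
  constructor
  · rintro ⟨hf, hfix⟩
    obtain ⟨h, rfl⟩ := (InfiniteGalois.mem_range_algebraMap_iff_fixed f).mpr hfix
    exact ⟨h, (S.isInftyKappaUnitCoricIn_algebraMap_iff Λ U h).mp hf, rfl⟩
  · rintro ⟨h, hh, rfl⟩
    exact ⟨(S.isInftyKappaUnitCoricIn_algebraMap_iff Λ U h).mpr hh, fun σ => σ.commutes h⟩

/-- In particular a `Gal(Λ/L_C)`-fixed `∞κ`-coric element is `κ`-coric "on the nose" after descent: its preimage in
`L_C` is unique and `κ`-coric (injectivity of `L_C ↪ L̄_C`). ([IUTchI] Ex 5.1 (i) p.124)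
[claim: Mochizuki2012, status: disputed] -/
theorem existsUnique_isKappaCoric_of_fixed [IsGalois (RatFunc Ω) Λ] {f : Λ} (hf : S.IsInftyKappaCoricIn Λ f)
    (hfix : ∀ σ : Λ ≃ₐ[RatFunc Ω] Λ, σ f = f) :
    ∃! g : RatFunc Ω, S.IsKappaCoric g ∧ algebraMap (RatFunc Ω) Λ g = f := by
  obtain ⟨g, hg, rfl⟩ := (S.isInftyKappaCoricIn_and_fixed_iff Λ _).mp ⟨hf, hfix⟩
  exact ⟨g, ⟨hg, rfl⟩, fun g' hg' => (algebraMap (RatFunc Ω) Λ).injective hg'.2⟩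

/-! ### Non-vacuity of the Galois hypothesis: `L̄_C` an algebraic closure of `L_C` in characteristic `0` -/

/-- The hypothesis `IsGalois (RatFunc Ω) Λ` holds for `Λ` an algebraic closure of `Ω(t)` (characteristic `0` fields
are perfect).  Kernel check of the instance path only. ([IUTchI] Rmk 3.1.7 (ii) p.67)
[claim: Mochizuki2012, status: disputed] -/
theorem isGalois_algebraicClosure_ratFunc : IsGalois (RatFunc Ω) (AlgebraicClosure (RatFunc Ω)) :=
  IsAlgClosure.isGalois (RatFunc Ω) _

end CriticalLocus

end Literature.IUT.HodgeTheaters
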